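import Summits.Langlands.Langlands.Theorems.PhantomRMYoshidaPhantomRMJunctionStringCountingDifferences
import HarnessLib

/-!
# Henniart 2002, Thm 1.7 (a): the counting argument, part 2 — reconstruction (§4.3–4.4)

Helper file of line `PhantomRMJunctionOfPieces` (crux stmt-Langlands-13643 `PhantomRMYoshida.PhantomRMJunction`),
registered stub F3d `stub_isEquivalent_of_finrank_homWD_stringModel_eq` (Henniart 2002 Thm 1.7 (a) in `Hom` form);
continues `…StringCountingDifferences` (same abstract setting: labels `K`, free twist `T`, `T`-invariant positive
dimension `d`, strings `S : Multiset (K × ℕ)`, probe counts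
`S.countP (fun p => ∃ j, j < p.2 ∧ p.2 ≤ j + a ∧ (T ^ j) p.1 = c)`).

Main result `multiset_eq_of_countP_topSlots_eq` (Henniart's reconstruction, the combinatorial core of Thm 1.7 (a)):
if `S`, `S'` have the same dimension `n ≤ P + 1`, `S` is not a single string `(k, 1)` with `d k = P + 1` (i.e.
"`σ` is not irreducible" when `P = n - 1`), and the probe counts agree for all `(c, a)` with `a ≥ 1`, `a · d c ≤ P`,
then `S = S'`.  Proof: the strings `(k, a)` with `(a + 1) · d k ≤ P` form a common part (part 1); at most two
strings survive on each side, each of dimension `≥ (P + 1) / 2`, and they are pinned by their top slots (`a = 1`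
probes) and the dimension (`eq_of_surviving`).

Consumer (prose): with `K` := isomorphism classes of irreducible continuous representations of `W_F`, `T` := twist
by `‖·‖`, `d` := dimension, `S` := the multiset of strings of a string decomposition of `σ`, and
`dim Hom_WD(c ⊗ Sp(a), σ) = S.countP (…)` ("`Hom` out of a string"), the theorem gives: equal `Hom`-dimensions
against standard strings `c ⊗ Sp(a)`, `a · dim c ≤ n - 1`, force equal string data, hence `σ ≅ σ'`.
Pure combinatorics (Mathlib only); no definitions; standard axioms only.
-/

noncomputable section

set_option linter.dupNamespace false

open scoped Classical
open Multiset

namespace Summit.Langlands.Langlands.Theorems.PhantomRMJunctionOfPieces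

variable {K : Type*} (T : Equiv.Perm K) (d : K → ℕ)

/-! ## Top slots, dimensions, and the strings that survive cancellation -/

/-- For strings of positive length, the `a = 1` probe counts top slots: `c` is among the top `1` slots of
`(k, b)` iff `c = T^{b-1} k`. [cite: HenniartBSMF2002, §4.4] -/
theorem countP_topSlots_one (S : Multiset (K × ℕ)) (hS : ∀ p ∈ S, 0 < p.2) (c : K) :
    S.countP (fun p => ∃ j : ℕ, j < p.2 ∧ p.2 ≤ j + 1 ∧ (T ^ j) p.1 = c) =
      S.countP (fun p => (T ^ (p.2 - 1)) p.1 = c) := by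
  refine Multiset.countP_congr rfl fun p hp => ?_
  have hb := hS p hp
  simp only [eq_iff_iff]
  constructor
  · rintro ⟨j, hj, hj1, hjc⟩
    have : p.2 - 1 = j := by omega
    rw [this, hjc]
  · intro h
    exact ⟨p.2 - 1, by omega, by omega, h⟩

/-- The dimension `Σ b · d k` of a multiset of strings is additive. [folklore] -/
theorem sdim_add (S R : Multiset (K × ℕ)) :
    ((S + R).map fun p : K × ℕ => p.2 * d p.1).sum =
      (S.map fun p : K × ℕ => p.2 * d p.1).sum + (R.map fun p : K × ℕ => p.2 * d p.1).sum := by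
  rw [Multiset.map_add, Multiset.sum_add]

/-- A string of a multiset has dimension at most the total dimension. [folklore] -/
theorem dim_le_sdim (S : Multiset (K × ℕ)) {p : K × ℕ} (hp : p ∈ S) :
    p.2 * d p.1 ≤ (S.map fun p : K × ℕ => p.2 * d p.1).sum := by
  obtain ⟨S₀, rfl⟩ := Multiset.exists_cons_of_mem hp
  rw [Multiset.map_cons, Multiset.sum_cons]
  exact Nat.le_add_right _ _

/-- A multiset of strings of positive lengths and positive head dimensions with total dimension `0` is empty.
[folklore] -/
theorem eq_zero_of_sdim_eq_zero (hdpos : ∀ k, 0 < d k) (S : Multiset (K × ℕ)) (hS : ∀ p ∈ S, 0 < p.2)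
    (h0 : (S.map fun p : K × ℕ => p.2 * d p.1).sum = 0) : S = 0 := by
  by_contra hne
  obtain ⟨p, hp⟩ := Multiset.exists_mem_of_ne_zero hne
  have h1 := dim_le_sdim d S hp
  have h2 : 0 < p.2 * d p.1 := Nat.mul_pos (hS p hp) (hdpos p.1)
  omega

/-- A surviving string (`(b + 1) · d k > P`) has dimension at least half the budget: `2 · (b · d k) ≥ P + 1`.
[cite: HenniartBSMF2002, §4.3] -/
theorem two_mul_dim_ge {P : ℕ} {p : K × ℕ} (hb : 0 < p.2) (hQ : P < (p.2 + 1) * d p.1) :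
    P + 1 ≤ 2 * (p.2 * d p.1) := by
  have h1 : (p.2 + 1) * d p.1 = p.2 * d p.1 + d p.1 := by ring
  have h2 : d p.1 ≤ p.2 * d p.1 := Nat.le_mul_of_pos_left _ hb
  omega

/-- At most two strings survive the cancellation: three surviving strings would have total dimension
`≥ 3 (P + 1) / 2 > P + 1`. [cite: HenniartBSMF2002, §4.3] -/
theorem card_le_two_of_surviving (P : ℕ) (R : Multiset (K × ℕ))
    (hR : ∀ p ∈ R, 0 < p.2 ∧ P < (p.2 + 1) * d p.1)
    (hP : (R.map fun p : K × ℕ => p.2 * d p.1).sum ≤ P + 1) : Multiset.card R ≤ 2 := by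
  by_contra h3
  rw [not_le] at h3
  obtain ⟨p, hp⟩ := Multiset.card_pos_iff_exists_mem.mp (by omega : 0 < Multiset.card R)
  obtain ⟨R₁, rfl⟩ := Multiset.exists_cons_of_mem hp
  have hc1 : 2 ≤ Multiset.card R₁ := by rw [Multiset.card_cons] at h3; omega
  obtain ⟨q, hq⟩ := Multiset.card_pos_iff_exists_mem.mp (by omega : 0 < Multiset.card R₁)
  obtain ⟨R₂, rfl⟩ := Multiset.exists_cons_of_mem hq
  have hc2 : 1 ≤ Multiset.card R₂ := by rw [Multiset.card_cons] at hc1; omega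
  obtain ⟨r, hr⟩ := Multiset.card_pos_iff_exists_mem.mp (by omega : 0 < Multiset.card R₂)
  obtain ⟨R₃, rfl⟩ := Multiset.exists_cons_of_mem hr
  simp only [Multiset.map_cons, Multiset.sum_cons] at hP
  have hp' := hR p (Multiset.mem_cons_self _ _)
  have hq' := hR q (Multiset.mem_cons_of_mem (Multiset.mem_cons_self _ _))
  have hr' := hR r (Multiset.mem_cons_of_mem (Multiset.mem_cons_of_mem (Multiset.mem_cons_self _ _)))
  have := two_mul_dim_ge d hp'.1 hp'.2
  have := two_mul_dim_ge d hq'.1 hq'.2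
  have := two_mul_dim_ge d hr'.1 hr'.2
  omega

/-- Two surviving strings fill the budget exactly, so each has length `1`. [cite: HenniartBSMF2002, §4.3] -/
theorem snd_eq_one_of_pair {P : ℕ} {p q : K × ℕ} (hdpos : ∀ k, 0 < d k) (hp : 0 < p.2) (hq : 0 < q.2)
    (hQp : P < (p.2 + 1) * d p.1) (hQq : P < (q.2 + 1) * d q.1)
    (hP : p.2 * d p.1 + q.2 * d q.1 ≤ P + 1) : p.2 = 1 := by
  have h1 : (p.2 + 1) * d p.1 = p.2 * d p.1 + d p.1 := by ring
  have h2 : (q.2 + 1) * d q.1 = q.2 * d q.1 + d q.1 := by ring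
  have h3 : d q.1 ≤ q.2 * d q.1 := Nat.le_mul_of_pos_left _ hq
  have h4 : p.2 * d p.1 ≤ 1 * d p.1 := by omega
  have h5 : p.2 ≤ 1 := Nat.le_of_mul_le_mul_right h4 (hdpos p.1)
  omega

/-- A surviving string whose head has dimension `> P` is alone and has length `1` and dimension `P + 1`.
[cite: HenniartBSMF2002, §4.3] -/
theorem eq_singleton_of_lt_d (hdpos : ∀ k, 0 < d k) (P : ℕ) (R : Multiset (K × ℕ)) (hR : ∀ p ∈ R, 0 < p.2)
    (hP : (R.map fun p : K × ℕ => p.2 * d p.1).sum ≤ P + 1) {p : K × ℕ} (hp : p ∈ R) (hdp : P < d p.1) :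
    R = {(p.1, 1)} ∧ d p.1 = P + 1 := by
  obtain ⟨R₀, rfl⟩ := Multiset.exists_cons_of_mem hp
  have hb := hR p (Multiset.mem_cons_self _ _)
  rw [Multiset.map_cons, Multiset.sum_cons] at hP
  have h1 : d p.1 ≤ p.2 * d p.1 := Nat.le_mul_of_pos_left _ hb
  have h2 : p.2 * d p.1 ≤ 1 * d p.1 := by omega
  have h3 : p.2 ≤ 1 := Nat.le_of_mul_le_mul_right h2 (hdpos p.1)
  have hb1 : p.2 = 1 := le_antisymm h3 hb
  have h0 : (R₀.map fun p : K × ℕ => p.2 * d p.1).sum = 0 := by omega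
  have hR0 : R₀ = 0 :=
    eq_zero_of_sdim_eq_zero d hdpos R₀ (fun q hq => hR q (Multiset.mem_cons_of_mem hq)) h0
  refine ⟨?_, by omega⟩
  rw [hR0, Multiset.cons_zero]
  congr 1
  exact Prod.ext rfl hb1

/-- Strings of length `1` are recovered from their top slots. [folklore] -/
theorem eq_map_top_of_snd_eq_one (R : Multiset (K × ℕ)) (h1 : ∀ p ∈ R, p.2 = 1) :
    R = (R.map fun p : K × ℕ => (T ^ (p.2 - 1)) p.1).map fun c => (c, 1) := by
  rw [Multiset.map_map]
  conv_lhs => rw [← Multiset.map_id R]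
  refine Multiset.map_congr rfl fun p hp => ?_
  have hb := h1 p hp
  simp only [Function.comp_apply, id_eq, hb, Nat.sub_self, pow_zero, Equiv.Perm.one_apply]
  exact Prod.ext rfl hb

/-! ## The endgame: at most two surviving strings, pinned by top slots and dimension -/

/-- **Endgame** (Henniart §4.3–4.4).  Two multisets of SURVIVING strings (`(b + 1) · d k > P`) of the same
dimension `≤ P + 1`, the first not a single `(k, 1)` with `d k = P + 1`, whose top-slot counts agree on labels of
dimension `≤ P`, are equal. [cite: HenniartBSMF2002, §4.3–4.4] -/
theorem eq_of_surviving (hd : ∀ k, d (T k) = d k) (hdpos : ∀ k, 0 < d k) (P : ℕ) (R R' : Multiset (K × ℕ))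
    (hR : ∀ p ∈ R, 0 < p.2 ∧ P < (p.2 + 1) * d p.1) (hR' : ∀ p ∈ R', 0 < p.2 ∧ P < (p.2 + 1) * d p.1)
    (hdim : (R.map fun p : K × ℕ => p.2 * d p.1).sum = (R'.map fun p : K × ℕ => p.2 * d p.1).sum)
    (hP : (R.map fun p : K × ℕ => p.2 * d p.1).sum ≤ P + 1)
    (hirr : ∀ k : K, R = {(k, 1)} → d k ≤ P)
    (hh1 : ∀ c : K, d c ≤ P → R.countP (fun p => (T ^ (p.2 - 1)) p.1 = c) =
      R'.countP (fun p => (T ^ (p.2 - 1)) p.1 = c)) :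
    R = R' := by
  have hP' : (R'.map fun p : K × ℕ => p.2 * d p.1).sum ≤ P + 1 := hdim ▸ hP
  -- (a) every head of `R` has dimension `≤ P`
  have hdR : ∀ p ∈ R, d p.1 ≤ P := by
    intro p hp
    by_contra hlt
    rw [not_le] at hlt
    obtain ⟨hRk, hdk⟩ := eq_singleton_of_lt_d d hdpos P R (fun q hq => (hR q hq).1) hP hp hlt
    have := hirr p.1 hRk
    omega
  -- (b) every head of `R'` has dimension `≤ P`: otherwise `R'` is a single undetectable string of dimension
  -- `P + 1` while `R` has a detectable top slot
  have hdR' : ∀ p ∈ R', d p.1 ≤ P := by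
    intro p hp
    by_contra hlt
    rw [not_le] at hlt
    obtain ⟨hRk, hdk⟩ := eq_singleton_of_lt_d d hdpos P R' (fun q hq => (hR' q hq).1) hP' hp hlt
    have hn : (R.map fun p : K × ℕ => p.2 * d p.1).sum = P + 1 := by
      rw [hdim, hRk, Multiset.map_singleton, Multiset.sum_singleton, one_mul, hdk]
    have hne : R ≠ 0 := by
      rintro rfl
      simp at hn
    obtain ⟨q, hq⟩ := Multiset.exists_mem_of_ne_zero hne
    have hdq : d ((T ^ (q.2 - 1)) q.1) ≤ P := by rw [d_pow_apply T d hd]; exact hdR q hq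
    have h1 := hh1 _ hdq
    have hposR : 0 < R.countP (fun p => (T ^ (p.2 - 1)) p.1 = (T ^ (q.2 - 1)) q.1) :=
      Multiset.countP_pos.mpr ⟨q, hq, rfl⟩
    have hzero : R'.countP (fun p => (T ^ (p.2 - 1)) p.1 = (T ^ (q.2 - 1)) q.1) = 0 := by
      rw [hRk]
      refine Multiset.countP_eq_zero.mpr fun x hx hx' => ?_
      rw [Multiset.mem_singleton] at hx
      subst hx
      simp only [Nat.sub_self, pow_zero, Equiv.Perm.one_apply] at hx'
      have h2 : d p.1 = d ((T ^ (q.2 - 1)) q.1) := by rw [hx']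
      rw [d_pow_apply T d hd] at h2
      have := hdR q hq
      omega
    omega
  -- (c) the multisets of top slots agree
  have htop : R.map (fun p : K × ℕ => (T ^ (p.2 - 1)) p.1) = R'.map (fun p : K × ℕ => (T ^ (p.2 - 1)) p.1) := by
    ext c
    rw [Multiset.count_map, Multiset.count_map, ← Multiset.countP_eq_card_filter,
      ← Multiset.countP_eq_card_filter]
    by_cases hc : d c ≤ P
    · have h := hh1 c hc
      rw [Multiset.countP_congr (s' := R) rfl fun x _ => propext (eq_comm (a := c)),
        Multiset.countP_congr (s' := R') rfl fun x _ => propext (eq_comm (a := c))]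
      exact h
    · rw [not_le] at hc
      rw [Multiset.countP_eq_zero.mpr, Multiset.countP_eq_zero.mpr]
      · rintro x hx rfl
        have := hdR' x hx
        rw [d_pow_apply T d hd] at hc
        omega
      · rintro x hx rfl
        have := hdR x hx
        rw [d_pow_apply T d hd] at hc
        omega
  have hcard : Multiset.card R = Multiset.card R' := by
    simpa only [Multiset.card_map] using congrArg Multiset.card htop
  have hle := card_le_two_of_surviving d P R hR hP
  -- (d) zero, one or two surviving strings
  obtain h0 | h1 | h2 : Multiset.card R = 0 ∨ Multiset.card R = 1 ∨ Multiset.card R = 2 := by omega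
  · rw [Multiset.card_eq_zero.mp h0, Multiset.card_eq_zero.mp (hcard ▸ h0 : Multiset.card R' = 0)]
  · obtain ⟨p, hp⟩ := Multiset.card_eq_one.mp h1
    obtain ⟨p', hp'⟩ := Multiset.card_eq_one.mp (hcard ▸ h1 : Multiset.card R' = 1)
    rw [hp, hp'] at htop hdim
    rw [Multiset.map_singleton, Multiset.map_singleton, Multiset.singleton_inj] at htop
    rw [Multiset.map_singleton, Multiset.map_singleton, Multiset.sum_singleton, Multiset.sum_singleton] at hdim
    have hdd : d p.1 = d p'.1 := by
      rw [← d_pow_apply T d hd (p.2 - 1) p.1, htop, d_pow_apply T d hd]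
    rw [hdd] at hdim
    have hb : p.2 = p'.2 := Nat.eq_of_mul_eq_mul_right (hdpos _) hdim
    rw [hb] at htop
    have hk : p.1 = p'.1 := (T ^ (p'.2 - 1)).injective htop
    rw [hp, hp']
    exact congrArg _ (Prod.ext hk hb)
  · obtain ⟨p, q, hpq⟩ := Multiset.card_eq_two.mp h2
    obtain ⟨p', q', hpq'⟩ := Multiset.card_eq_two.mp (hcard ▸ h2 : Multiset.card R' = 2)
    have hsum : ∀ x y : K × ℕ, (({x, y} : Multiset (K × ℕ)).map fun p : K × ℕ => p.2 * d p.1).sum =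
        x.2 * d x.1 + y.2 * d y.1 := fun x y => by
      rw [Multiset.insert_eq_cons, Multiset.map_cons, Multiset.sum_cons, Multiset.map_singleton,
        Multiset.sum_singleton]
    have h1R : ∀ x ∈ R, x.2 = 1 := by
      rw [hpq] at hP hR ⊢
      rw [hsum] at hP
      intro x hx
      rw [Multiset.insert_eq_cons, Multiset.mem_cons, Multiset.mem_singleton] at hx
      have hp1 := hR p (by simp)
      have hq1 := hR q (by simp)
      rcases hx with rfl | rfl
      · exact snd_eq_one_of_pair d hdpos hp1.1 hq1.1 hp1.2 hq1.2 hP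
      · exact snd_eq_one_of_pair d hdpos hq1.1 hp1.1 hq1.2 hp1.2 (by omega)
    have h1R' : ∀ x ∈ R', x.2 = 1 := by
      rw [hpq'] at hP' hR' ⊢
      rw [hsum] at hP'
      intro x hx
      rw [Multiset.insert_eq_cons, Multiset.mem_cons, Multiset.mem_singleton] at hx
      have hp1 := hR' p' (by simp)
      have hq1 := hR' q' (by simp)
      rcases hx with rfl | rfl
      · exact snd_eq_one_of_pair d hdpos hp1.1 hq1.1 hp1.2 hq1.2 hP'
      · exact snd_eq_one_of_pair d hdpos hq1.1 hp1.1 hq1.2 hp1.2 (by omega)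
    rw [eq_map_top_of_snd_eq_one T R h1R, eq_map_top_of_snd_eq_one T R' h1R', htop]

/-! ## Henniart's reconstruction -/

/-- **Henniart 2002, Thm 1.7 (a) — the counting argument** (abstract form).  Labels `K` with a free twist `T` and a
`T`-invariant positive dimension `d`; strings `S S' : Multiset (K × ℕ)` (`(head, length)`, lengths `≥ 1`) of the same
dimension `n ≤ P + 1`, `S` not a single `(k, 1)` with `d k = P + 1`.  If for every probe `(c, a)`, `a ≥ 1`,
`a · d c ≤ P`, the numbers of strings having `c` among their top `min(a, b)` slots agree, then `S = S'`.
Proof: the strings `(k, a)` with `(a + 1) · d k ≤ P` have equal multiplicities (`count_eq_of_hh`, second differences,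
§4.2); they form a common part; the surviving strings are at most two on each side and are pinned by their top slots
and the dimension (`eq_of_surviving`, §4.3–4.4). [cite: HenniartBSMF2002, Thm. 1.7 (a), §4.1–4.4] -/
theorem multiset_eq_of_countP_topSlots_eq (hd : ∀ k, d (T k) = d k) (hdpos : ∀ k, 0 < d k)
    (hfree : ∀ (k : K) (j : ℕ), 0 < j → (T ^ j) k ≠ k) (P : ℕ) (S S' : Multiset (K × ℕ))
    (hS : ∀ p ∈ S, 0 < p.2) (hS' : ∀ p ∈ S', 0 < p.2)
    (hdim : (S.map fun p : K × ℕ => p.2 * d p.1).sum = (S'.map fun p : K × ℕ => p.2 * d p.1).sum)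
    (hP : (S.map fun p : K × ℕ => p.2 * d p.1).sum ≤ P + 1)
    (hirr : ∀ k : K, S = {(k, 1)} → d k ≤ P)
    (hh : ∀ (c : K) (a : ℕ), 0 < a → a * d c ≤ P →
      S.countP (fun p => ∃ j : ℕ, j < p.2 ∧ p.2 ≤ j + a ∧ (T ^ j) p.1 = c) =
      S'.countP (fun p => ∃ j : ℕ, j < p.2 ∧ p.2 ≤ j + a ∧ (T ^ j) p.1 = c)) :
    S = S' := by
  -- the common part: strings `(k, b)` with `(b + 1) · d k ≤ P` have equal multiplicities
  have hC : S.filter (fun p : K × ℕ => (p.2 + 1) * d p.1 ≤ P) =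
      S'.filter (fun p : K × ℕ => (p.2 + 1) * d p.1 ≤ P) := by
    ext p
    rw [Multiset.count_filter, Multiset.count_filter]
    split_ifs with hq
    · rcases Nat.eq_zero_or_pos p.2 with h0 | hpos
      · rw [Multiset.count_eq_zero_of_notMem fun h => absurd (hS p h) (by omega),
          Multiset.count_eq_zero_of_notMem fun h => absurd (hS' p h) (by omega)]
      · exact count_eq_of_hh hd hfree P hh p.1 p.2 hpos hq
    · rfl
  have hSd := Multiset.filter_add_not (fun p : K × ℕ => (p.2 + 1) * d p.1 ≤ P) S
  have hS'd := Multiset.filter_add_not (fun p : K × ℕ => (p.2 + 1) * d p.1 ≤ P) S'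
  -- it suffices to identify the surviving parts
  suffices hRR : S.filter (fun p : K × ℕ => ¬ (p.2 + 1) * d p.1 ≤ P) =
      S'.filter (fun p : K × ℕ => ¬ (p.2 + 1) * d p.1 ≤ P) by
    rw [← hSd, ← hS'd, hC, hRR]
  have hRmem : ∀ p ∈ S.filter (fun p : K × ℕ => ¬ (p.2 + 1) * d p.1 ≤ P), 0 < p.2 ∧ P < (p.2 + 1) * d p.1 :=
    fun p hp => by
      rw [Multiset.mem_filter] at hp
      exact ⟨hS p hp.1, not_le.mp hp.2⟩
  have hR'mem : ∀ p ∈ S'.filter (fun p : K × ℕ => ¬ (p.2 + 1) * d p.1 ≤ P), 0 < p.2 ∧ P < (p.2 + 1) * d p.1 :=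
    fun p hp => by
      rw [Multiset.mem_filter] at hp
      exact ⟨hS' p hp.1, not_le.mp hp.2⟩
  have hdimS := hdim
  rw [← hSd, ← hS'd, sdim_add, sdim_add, hC] at hdimS
  have hdimR : ((S.filter (fun p : K × ℕ => ¬ (p.2 + 1) * d p.1 ≤ P)).map fun p : K × ℕ => p.2 * d p.1).sum =
      ((S'.filter (fun p : K × ℕ => ¬ (p.2 + 1) * d p.1 ≤ P)).map fun p : K × ℕ => p.2 * d p.1).sum := by
    omega
  have hPS := hP
  rw [← hSd, sdim_add] at hPS
  have hPR : ((S.filter (fun p : K × ℕ => ¬ (p.2 + 1) * d p.1 ≤ P)).map fun p : K × ℕ => p.2 * d p.1).sum ≤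
      P + 1 := by omega
  -- the surviving part of `S` is not an undetectable single string: otherwise the common part is empty and
  -- `S` itself would be one
  have hirrR : ∀ k : K, S.filter (fun p : K × ℕ => ¬ (p.2 + 1) * d p.1 ≤ P) = {(k, 1)} → d k ≤ P := by
    intro k hk
    by_contra hlt
    rw [not_le] at hlt
    rw [hk, Multiset.map_singleton, Multiset.sum_singleton, one_mul] at hPS
    dsimp only at hPS
    have hC0 : ((S.filter (fun p : K × ℕ => (p.2 + 1) * d p.1 ≤ P)).map fun p : K × ℕ => p.2 * d p.1).sum = 0 := by
      omega
    have hCz := eq_zero_of_sdim_eq_zero d hdpos _ (fun p hp => hS p (Multiset.mem_of_mem_filter hp)) hC0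
    have hSR : S = {(k, 1)} := by rw [← hSd, hCz, zero_add, hk]
    have := hirr k hSR
    omega
  -- the `a = 1` probes pass to the surviving parts
  have hh1 : ∀ c : K, d c ≤ P →
      (S.filter (fun p : K × ℕ => ¬ (p.2 + 1) * d p.1 ≤ P)).countP (fun p => (T ^ (p.2 - 1)) p.1 = c) =
      (S'.filter (fun p : K × ℕ => ¬ (p.2 + 1) * d p.1 ≤ P)).countP (fun p => (T ^ (p.2 - 1)) p.1 = c) := by
    intro c hc
    have h := hh c 1 Nat.one_pos (by rwa [one_mul])
    rw [← hSd, ← hS'd, Multiset.countP_add, Multiset.countP_add, hC] at h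
    rw [← countP_topSlots_one T _ (fun p hp => (hRmem p hp).1) c,
      ← countP_topSlots_one T _ (fun p hp => (hR'mem p hp).1) c]
    omega
  exact eq_of_surviving T d hd hdpos P _ _ hRmem hR'mem hdimR hPR hirrR hh1

/-- **Registered sub-goal (the counting argument, Henniart 2002 Thm 1.7 (a), abstract form)** — see
`multiset_eq_of_countP_topSlots_eq`. [cite: HenniartBSMF2002, Thm. 1.7 (a), §4.1–4.4] -/
theorem stub_multiset_eq_of_countP_topSlots_eq : ∀ (K : Type) (T : Equiv.Perm K) (d : K → ℕ), (∀ k, d (T k) = d k) → (∀ k, 0 < d k) → (∀ (k : K) (j : ℕ), 0 < j → (T ^ j) k ≠ k) → ∀ (P : ℕ) (S S' : Multiset (K × ℕ)), (∀ p ∈ S, 0 < p.2) → (∀ p ∈ S', 0 < p.2) → (S.map fun p : K × ℕ => p.2 * d p.1).sum = (S'.map fun p : K × ℕ => p.2 * d p.1).sum → (S.map fun p : K × ℕ => p.2 * d p.1).sum ≤ P + 1 → (∀ k : K, S = {(k, 1)} → d k ≤ P) → (∀ (c : K) (a : ℕ), 0 < a → a * d c ≤ P → S.countP (fun p => ∃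 j : ℕ, j < p.2 ∧ p.2 ≤ j + a ∧ (T ^ j) p.1 = c) = S'.countP (fun p => ∃ j : ℕ, j < p.2 ∧ p.2 ≤ j + a ∧ (T ^ j) p.1 = c)) → S = S' :=
  fun _ T d hd hdpos hfree P S S' hS hS' hdim hP hirr hh =>
    multiset_eq_of_countP_topSlots_eq T d hd hdpos hfree P S S' hS hS' hdim hP hirr hh

end Summit.Langlands.Langlands.Theorems.PhantomRMJunctionOfPieces

end
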